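import Summits.RiemannHypothesis.RiemannHypothesis.Theses.SpectralTrace
import Summits.RiemannHypothesis.RiemannHypothesis.Theorems.WindowTraceArch.Negative.LocalWeylTools
import Literature.NumberTheory.LFunctions.WeilMellinBounds
import HarnessLib

/-!
# `SpectralThesis` (stmt-RiemannHypothesis-0187): finite rigidity of witnesses

Negative-lane lemmas for the route target `X = SpectralThesis` of route SpectralTrace
(refuter / cdisprove seat; supports stmt-RiemannHypothesis-0187).

* `eq_zero_of_sum_weilMellin_eq_zero` : the point evaluations `g ↦ ĝ(1/2 + iu)` at finitely many
  distinct real `u` are LINEARLY INDEPENDENT functionals on the Weil tests (induction on the finite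
  set: test the relation on `g'`, `(g')^(1/2+iu) = -iu ĝ(1/2+iu)` (`weilMellin_deriv`), and
  subtract `a` times the relation — this kills the node `a` and twists the other coefficients by
  `u - a ≠ 0`; a single node is killed by a modulated bump, `exists_weilMellin_ne_zero`).
* Consequences for real families `γ` reproducing `W` on all Weil tests ("witnesses of `X`"):
  `finset_eq_empty_of_sum_weilMellin_eq_zero`, `not_trace_subtype_notMem_of_trace` (no finite
  DELETION), `not_trace_sum_elim_of_trace` (no finite INSERTION), `not_trace_update_of_trace` (no
  single MOVE), `card_filter_eq_of_traces_agree_off_finset` (GENERAL: two witnesses agreeing off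
  finite sets carry the same finite multiset there): a witness cannot be patched at finitely many
  points — any "quasi-zeros + correction" construction must correct infinitely many points or none.
-/

noncomputable section

open Complex Set MeasureTheory Filter

namespace Summit.RiemannHypothesis.RiemannHypothesis.Theorems.SpectralThesis.Negative

open Literature.NumberTheory.LFunctions
open Summit.RiemannHypothesis.RiemannHypothesis.Theorems.WindowTraceArch.Negative

variable {ι : Type*} {γ : ι → ℝ}

/-- For every real `u` some Weil test has `ĝ(1/2 + iu) ≠ 0` (a narrow bump modulated to `u`:
`exists_bump_lower`, `weilMellin_modulate`). [folklore] -/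
theorem exists_weilMellin_ne_zero (u : ℝ) :
    ∃ g : ℝ → ℂ, IsWeilTest g ∧ weilMellin g (1 / 2 + (u : ℂ) * I) ≠ 0 := by
  obtain ⟨h, hh, -, -, c, hc, hlow⟩ := exists_bump_lower (δ := 1 / 2) one_half_pos le_rfl
  refine ⟨fun t => cexp (-((u * t : ℝ) : ℂ) * I) * h t, isWeilTest_modulate hh u, ?_⟩
  rw [weilMellin_modulate h u u]
  intro h0
  have h1 := hlow (u - u) (by simp)
  rw [h0, norm_zero, zero_pow two_ne_zero] at h1
  linarith

/-- **Linear independence of point evaluations on the critical line**: if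
`Σ_{u ∈ J} c_u ĝ(1/2 + iu) = 0` for every Weil test `g` (`J` a finite set of reals), then all
`c_u = 0`. [folklore] -/
theorem eq_zero_of_sum_weilMellin_eq_zero (J : Finset ℝ) (c : ℝ → ℂ)
    (h : ∀ g : ℝ → ℂ, IsWeilTest g →
      ∑ u ∈ J, c u * weilMellin g (1 / 2 + (u : ℂ) * I) = 0) :
    ∀ u ∈ J, c u = 0 := by
  classical
  induction J using Finset.induction_on generalizing c with
  | empty => simp
  | insert a s ha ih =>
    -- the twisted coefficients `c u * (u - a)` satisfy the relation on `s`
    have h' : ∀ g : ℝ → ℂ, IsWeilTest g →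
        ∑ u ∈ s, (c u * ((u : ℂ) - a)) * weilMellin g (1 / 2 + (u : ℂ) * I) = 0 := by
      intro g hg
      have h1 := h g hg
      have h2 := h (deriv g) hg.deriv
      simp only [weilMellin_deriv hg] at h2
      rw [Finset.sum_insert ha] at h1 h2
      have hpt : ∀ u : ℝ, (c u * ((u : ℂ) - a)) * weilMellin g (1 / 2 + (u : ℂ) * I) =
          I * (c u * (-(1 / 2 + (u : ℂ) * I - 1 / 2) * weilMellin g (1 / 2 + (u : ℂ) * I))) -
            (a : ℂ) * (c u * weilMellin g (1 / 2 + (u : ℂ) * I)) := fun u => by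
        linear_combination ((u : ℂ) * c u * weilMellin g (1 / 2 + (u : ℂ) * I)) * Complex.I_mul_I
      rw [Finset.sum_congr rfl (fun u _ => hpt u), Finset.sum_sub_distrib, ← Finset.mul_sum,
        ← Finset.mul_sum]
      have e1 : ∑ u ∈ s, c u * weilMellin g (1 / 2 + (u : ℂ) * I) =
          -(c a * weilMellin g (1 / 2 + (a : ℂ) * I)) := by
        linear_combination h1
      have e2 : ∑ u ∈ s, c u * (-(1 / 2 + (u : ℂ) * I - 1 / 2) * weilMellin g (1 / 2 + (u : ℂ) * I)) =
          -(c a * (-(1 / 2 + (a : ℂ) * I - 1 / 2) * weilMellin g (1 / 2 + (a : ℂ) * I))) := by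
        linear_combination h2
      rw [e1, e2]
      linear_combination ((a : ℂ) * c a * weilMellin g (1 / 2 + (a : ℂ) * I)) * Complex.I_mul_I
    -- by induction they vanish, hence `c` vanishes on `s`
    have hs : ∀ u ∈ s, c u = 0 := by
      intro u hu
      have h0 := ih (fun u => c u * ((u : ℂ) - a)) h' u hu
      have hne : (u : ℂ) - a ≠ 0 :=
        sub_ne_zero.2 (by exact_mod_cast ne_of_mem_of_not_mem hu ha)
      exact (mul_eq_zero.1 h0).resolve_right hne
    -- the relation reduces to `c a * ĝ(a) = 0` for all `g`
    intro u hu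
    rcases Finset.mem_insert.1 hu with hua | hu'
    · rw [hua]
      obtain ⟨g, hg, hga⟩ := exists_weilMellin_ne_zero a
      have h1 := h g hg
      rw [Finset.sum_insert ha,
        Finset.sum_eq_zero (fun v hv => by rw [hs v hv, zero_mul]), add_zero] at h1
      exact (mul_eq_zero.1 h1).resolve_right hga
    · exact hs u hu'

/-- If `Σ_{i ∈ A} ĝ(1/2 + iγ_i) = 0` for every Weil test `g`, the finite index set `A` is empty
(group by values; linear independence). [folklore] -/
theorem finset_eq_empty_of_sum_weilMellin_eq_zero (A : Finset ι)
    (h : ∀ g : ℝ → ℂ, IsWeilTest g → ∑ i ∈ A, weilMellin g (1 / 2 + (γ i : ℂ) * I) = 0) :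
    A = ∅ := by
  classical
  by_contra hA
  obtain ⟨i₀, hi₀⟩ := Finset.nonempty_iff_ne_empty.2 hA
  have hind := eq_zero_of_sum_weilMellin_eq_zero (A.image γ)
    (fun u => ((A.filter (fun i => γ i = u)).card : ℂ)) (fun g hg => by
      refine Eq.trans ?_ (h g hg)
      rw [← Finset.sum_fiberwise_of_maps_to (fun i hi => Finset.mem_image_of_mem γ hi)]
      refine Finset.sum_congr rfl fun u _ => ?_
      rw [Finset.sum_congr rfl (fun i hi => by rw [(Finset.mem_filter.1 hi).2]), Finset.sum_const,
        nsmul_eq_mul])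
  have h0 := hind (γ i₀) (Finset.mem_image_of_mem γ hi₀)
  have hpos : 0 < (A.filter (fun i => γ i = γ i₀)).card :=
    Finset.card_pos.2 ⟨i₀, Finset.mem_filter.2 ⟨hi₀, rfl⟩⟩
  exact absurd h0 (by exact_mod_cast hpos.ne')

/-- **No finite deletion**: removing a non-empty finite set of points from a real family
reproducing `W` on all Weil tests never gives such a family. [folklore] -/
theorem not_trace_subtype_notMem_of_trace
    (h : ∀ g : ℝ → ℂ, IsWeilTest g →
      HasSum (fun i => weilMellin g (1 / 2 + (γ i : ℂ) * I)) (weilFunctional g))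
    (A : Finset ι) (hA : A.Nonempty) :
    ¬ ∀ g : ℝ → ℂ, IsWeilTest g →
      HasSum (fun i : {i // i ∉ A} => weilMellin g (1 / 2 + (γ i : ℂ) * I)) (weilFunctional g) := by
  intro h'
  refine hA.ne_empty (finset_eq_empty_of_sum_weilMellin_eq_zero (γ := γ) A fun g hg => ?_)
  have h1 := h g hg
  have h2 := (Finset.hasSum_compl_iff (f := fun i => weilMellin g (1 / 2 + (γ i : ℂ) * I)) A).1
    (h' g hg)
  have h3 := h1.unique h2
  linear_combination -h3

/-- **No finite insertion**: adding `m ≥ 1` points to a real family reproducing `W` on all Weil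
tests never gives such a family. [folklore] -/
theorem not_trace_sum_elim_of_trace
    (h : ∀ g : ℝ → ℂ, IsWeilTest g →
      HasSum (fun i => weilMellin g (1 / 2 + (γ i : ℂ) * I)) (weilFunctional g))
    {m : ℕ} (hm : 0 < m) (δ : Fin m → ℝ) :
    ¬ ∀ g : ℝ → ℂ, IsWeilTest g →
      HasSum (fun x : ι ⊕ Fin m => weilMellin g (1 / 2 + ((Sum.elim γ δ x : ℝ) : ℂ) * I))
        (weilFunctional g) := by
  intro h'
  classical
  have key := finset_eq_empty_of_sum_weilMellin_eq_zero (γ := Sum.elim γ δ)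
    ((Finset.univ : Finset (Fin m)).map ⟨Sum.inr, Sum.inr_injective⟩) (fun g hg => ?_)
  · rw [Finset.map_eq_empty, Finset.univ_eq_empty_iff] at key
    exact key.false ⟨0, hm⟩
  · have h1 := h' g hg
    have hl : HasSum (fun i : ι => weilMellin g (1 / 2 + ((Sum.elim γ δ (Sum.inl i) : ℝ) : ℂ) * I))
        (weilFunctional g) := h g hg
    have hr : HasSum (fun j : Fin m => weilMellin g (1 / 2 + ((Sum.elim γ δ (Sum.inr j) : ℝ) : ℂ) * I))
        (∑ j, weilMellin g (1 / 2 + ((δ j : ℝ) : ℂ) * I)) := hasSum_fintype _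
    have h2 := HasSum.sum
      (f := fun x => weilMellin g (1 / 2 + ((Sum.elim γ δ x : ℝ) : ℂ) * I)) hl hr
    have h3 := h1.unique h2
    rw [Finset.sum_map]
    simp only [Function.Embedding.coeFn_mk, Sum.elim_inr]
    linear_combination -h3

/-- **No single move**: changing the value of a real family reproducing `W` on all Weil tests at
one index, to a different value, never gives such a family. [folklore] -/
theorem not_trace_update_of_trace [DecidableEq ι]
    (h : ∀ g : ℝ → ℂ, IsWeilTest g →
      HasSum (fun i => weilMellin g (1 / 2 + (γ i : ℂ) * I)) (weilFunctional g))
    (i₀ : ι) {v : ℝ} (hv : v ≠ γ i₀) :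
    ¬ ∀ g : ℝ → ℂ, IsWeilTest g →
      HasSum (fun i => weilMellin g (1 / 2 + ((Function.update γ i₀ v i : ℝ) : ℂ) * I))
        (weilFunctional g) := by
  intro h'
  have hsum : ∀ g : ℝ → ℂ, IsWeilTest g →
      weilMellin g (1 / 2 + (v : ℂ) * I) - weilMellin g (1 / 2 + (γ i₀ : ℂ) * I) = 0 := by
    intro g hg
    have h1 := (h g hg).update i₀ (weilMellin g (1 / 2 + (v : ℂ) * I))
    have h2 := h' g hg
    have hfun : (fun i => weilMellin g (1 / 2 + ((Function.update γ i₀ v i : ℝ) : ℂ) * I)) =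
        Function.update (fun i => weilMellin g (1 / 2 + (γ i : ℂ) * I)) i₀
          (weilMellin g (1 / 2 + (v : ℂ) * I)) := by
      funext i
      exact Function.apply_update (α := fun _ => ℝ) (β := fun _ => ℂ)
        (fun _ (x : ℝ) => weilMellin g (1 / 2 + (x : ℂ) * I)) γ i₀ v i
    rw [hfun] at h2
    have h3 := h2.unique h1
    linear_combination -h3
  have hind := eq_zero_of_sum_weilMellin_eq_zero {v, γ i₀}
    (fun u => if u = v then 1 else -1) (fun g hg => by
      rw [Finset.sum_pair hv, if_pos rfl, if_neg (Ne.symm hv), one_mul, neg_one_mul, ← sub_eq_add_neg]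
      exact hsum g hg)
  have := hind v (Finset.mem_insert_self _ _)
  simp at this

/-- **General finite rigidity**: two real families reproducing `W` on all Weil tests that agree
outside finite index sets `A`, `A'` (through a bijection of the complements) carry the SAME finite
multiset on `A` and `A'`. [folklore] -/
theorem card_filter_eq_of_traces_agree_off_finset {ι' : Type*} {γ' : ι' → ℝ}
    (h : ∀ g : ℝ → ℂ, IsWeilTest g →
      HasSum (fun i => weilMellin g (1 / 2 + (γ i : ℂ) * I)) (weilFunctional g))
    (h' : ∀ g : ℝ → ℂ, IsWeilTest g →
      HasSum (fun i' => weilMellin g (1 / 2 + (γ' i' : ℂ) * I)) (weilFunctional g))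
    (A : Finset ι) (A' : Finset ι')
    (e : {i // i ∉ A} ≃ {i' // i' ∉ A'}) (he : ∀ i, γ' (e i) = γ i) (u : ℝ) :
    (A.filter (fun i => γ i = u)).card = (A'.filter (fun i' => γ' i' = u)).card := by
  classical
  -- the two finite sums agree on every Weil test
  have hS : ∀ g : ℝ → ℂ, IsWeilTest g →
      ∑ i ∈ A, weilMellin g (1 / 2 + (γ i : ℂ) * I) =
        ∑ i' ∈ A', weilMellin g (1 / 2 + (γ' i' : ℂ) * I) := by
    intro g hg
    set f : ι → ℂ := fun i => weilMellin g (1 / 2 + (γ i : ℂ) * I) with hf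
    set f' : ι' → ℂ := fun i' => weilMellin g (1 / 2 + (γ' i' : ℂ) * I) with hf'
    have h1 : HasSum (fun x : {x // x ∉ A} => f x) (weilFunctional g - ∑ i ∈ A, f i) :=
      (Finset.hasSum_compl_iff A).2 (by rw [sub_add_cancel]; exact h g hg)
    have h2 : HasSum (fun x : {x // x ∉ A'} => f' x) (weilFunctional g - ∑ i' ∈ A', f' i') :=
      (Finset.hasSum_compl_iff A').2 (by rw [sub_add_cancel]; exact h' g hg)
    have h3 : HasSum ((fun x : {x // x ∉ A'} => f' x) ∘ e) (weilFunctional g - ∑ i' ∈ A', f' i') :=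
      (e.hasSum_iff).2 h2
    have hfe : ((fun x : {x // x ∉ A'} => f' x) ∘ e) = fun x : {x // x ∉ A} => f x := by
      funext x
      simp only [Function.comp_apply, hf, hf', he]
    rw [hfe] at h3
    have h4 := h1.unique h3
    linear_combination -h4
  -- group by values on `J` and apply linear independence
  set J : Finset ℝ := A.image γ ∪ A'.image γ' with hJ
  have eA : ∀ g : ℝ → ℂ, ∑ v ∈ J, ((A.filter (fun i => γ i = v)).card : ℂ) *
      weilMellin g (1 / 2 + (v : ℂ) * I) = ∑ i ∈ A, weilMellin g (1 / 2 + (γ i : ℂ) * I) := by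
    intro g
    rw [← Finset.sum_fiberwise_of_maps_to (fun i hi =>
      (Finset.mem_union_left _ (Finset.mem_image_of_mem γ hi) : γ i ∈ J))]
    refine Finset.sum_congr rfl fun v _ => ?_
    rw [Finset.sum_congr rfl (fun i hi => by rw [(Finset.mem_filter.1 hi).2]), Finset.sum_const,
      nsmul_eq_mul]
  have eA' : ∀ g : ℝ → ℂ, ∑ v ∈ J, ((A'.filter (fun i' => γ' i' = v)).card : ℂ) *
      weilMellin g (1 / 2 + (v : ℂ) * I) = ∑ i' ∈ A', weilMellin g (1 / 2 + (γ' i' : ℂ) * I) := by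
    intro g
    rw [← Finset.sum_fiberwise_of_maps_to (fun i hi =>
      (Finset.mem_union_right _ (Finset.mem_image_of_mem γ' hi) : γ' i ∈ J))]
    refine Finset.sum_congr rfl fun v _ => ?_
    rw [Finset.sum_congr rfl (fun i hi => by rw [(Finset.mem_filter.1 hi).2]), Finset.sum_const,
      nsmul_eq_mul]
  have hind := eq_zero_of_sum_weilMellin_eq_zero J
    (fun v => ((A.filter (fun i => γ i = v)).card : ℂ) - ((A'.filter (fun i' => γ' i' = v)).card : ℂ))
    (fun g hg => by
      simp only [sub_mul, Finset.sum_sub_distrib]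
      rw [eA, eA', hS g hg, sub_self])
  by_cases hu : u ∈ J
  · have h0 := hind u hu
    exact_mod_cast sub_eq_zero.1 h0
  · have hA0 : A.filter (fun i => γ i = u) = ∅ := Finset.filter_eq_empty_iff.2 fun i hi hiu =>
      hu (Finset.mem_union_left _ (Finset.mem_image.2 ⟨i, hi, hiu⟩))
    have hA'0 : A'.filter (fun i' => γ' i' = u) = ∅ := Finset.filter_eq_empty_iff.2 fun i hi hiu =>
      hu (Finset.mem_union_right _ (Finset.mem_image.2 ⟨i, hi, hiu⟩))
    rw [hA0, hA'0, Finset.card_empty, Finset.card_empty]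

end Summit.RiemannHypothesis.RiemannHypothesis.Theorems.SpectralThesis.Negative

end
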